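import Mathlib

/-!
# Scalar curvature of the round cap profile
(crux stmt-SmoothPoincare4-10871 `EntropyRung.SubcylindricalExistence`, line
`fat-conical-core-avr-logsobolev`, helper stub `helper_roundProfileCurvature` of lead c4's skeleton)

Pure one-variable calculus. In the capping construction the conformal factor in the flat chart is
`Φ = prof (‖y‖²)`, and the scalar curvature of `G = Φ² δ` is
`R_G = −6 prof⁻³ (8 prof'(s) + 4 s prof''(s))` with `s = ‖y‖²`. On the round cap region
`prof s = 2Aa/(a²+s)` for `0 ≤ s ≤ sJ` (stereographic picture of the round `S⁴(A)`), and there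
`R_G = 12/A²`.

Proof: for `0 ≤ s < sJ` the profile agrees with `R(t) = 2Aa/(a²+t)` on `[s, sJ)`, a neighbourhood
of `s` inside `[s, ∞)`; since `prof` and `deriv prof` are differentiable (`prof` is `C^∞`), their
derivatives at `s` are identified one-sidedly (`uniqueDiffWithinAt_Ici`) with
`R'(s) = −2Aa/(a²+s)²` and `R''(s) = 4Aa/(a²+s)³`; then
`8R' + 4sR'' = −16Aa·a²/(a²+s)³` and `−6 R⁻³ · (8R' + 4sR'') = 12/A²` (`field_simp; ring`).
Everything is proved from Mathlib; no definition, no named fact.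
-/

noncomputable section

open scoped Topology ContDiff
open Set Filter

-- the registered namespace `Summit.SmoothPoincare4.SmoothPoincare4.Theorems` repeats a component
set_option linter.dupNamespace false

namespace Summit.SmoothPoincare4.SmoothPoincare4.Theorems

namespace RoundProfileCurvatureAux

/-- One-sided identification of a derivative: if `f` is differentiable at `s`, agrees with `g` on
`[s, sJ)` with `s < sJ`, and `g` has derivative `g'` at `s`, then `deriv f s = g'`. -/
theorem deriv_eq_of_eqOn_Ico {f g : ℝ → ℝ} {s sJ g' : ℝ} (hf : DifferentiableAt ℝ f s)
    (hs : s < sJ) (hfg : ∀ t, s ≤ t → t < sJ → f t = g t) (hg : HasDerivAt g g' s) :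
    deriv f s = g' := by
  have h1 : HasDerivWithinAt f (deriv f s) (Ici s) s := hf.hasDerivAt.hasDerivWithinAt
  have h2 : HasDerivWithinAt f g' (Ici s) s := by
    refine hg.hasDerivWithinAt.congr_of_eventuallyEq ?_ (hfg s le_rfl hs)
    filter_upwards [Ico_mem_nhdsGE hs] with t ht
    exact hfg t ht.1 ht.2
  exact (uniqueDiffWithinAt_Ici s).eq_deriv _ h1 h2

/-- First derivative of the round profile `t ↦ 2Aa/(a²+t)` where `a² + t ≠ 0`. -/
theorem hasDerivAt_round (A a : ℝ) {t : ℝ} (ht : a ^ 2 + t ≠ 0) :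
    HasDerivAt (fun y : ℝ ↦ 2 * A * a / (a ^ 2 + y)) (-(2 * A * a) / (a ^ 2 + t) ^ 2) t := by
  have h := (hasDerivAt_const t (2 * A * a)).fun_div ((hasDerivAt_id' t).const_add (a ^ 2)) ht
  exact h.congr_deriv (by ring)

/-- Second derivative of the round profile: derivative of `t ↦ −2Aa/(a²+t)²` where `a² + t ≠ 0`. -/
theorem hasDerivAt_round_deriv (A a : ℝ) {t : ℝ} (ht : a ^ 2 + t ≠ 0) :
    HasDerivAt (fun y : ℝ ↦ -(2 * A * a) / (a ^ 2 + y) ^ 2) (4 * A * a / (a ^ 2 + t) ^ 3) t := by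
  have h := (hasDerivAt_const t (-(2 * A * a))).fun_div
    (((hasDerivAt_id' t).const_add (a ^ 2)).fun_pow 2) (pow_ne_zero 2 ht)
  refine h.congr_deriv ?_
  field_simp
  ring

end RoundProfileCurvatureAux

/-- Helper stub `helper_roundProfileCurvature`: on the round cap region, where the profile is
`prof s = 2Aa/(a²+s)` for `0 ≤ s ≤ sJ`, the flat-chart scalar curvature expression
`−6 prof(s)⁻³ (8 prof'(s) + 4 s prof''(s))` equals `12/A²` for every `0 ≤ s < sJ`
(the scalar curvature of the round `S⁴(A)`). -/
theorem helper_roundProfileCurvature : ∀ (A a : ℝ), 0 < A → 0 < a → ∀ (prof : ℝ → ℝ) (sJ : ℝ), ContDiff ℝ ∞ prof → 0 < sJ →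
      (∀ s, 0 ≤ s → s ≤ sJ → prof s = 2 * A * a / (a ^ 2 + s)) →
      ∀ s, 0 ≤ s → s < sJ →
        -6 * (prof s ^ 3)⁻¹ * (8 * deriv prof s + 4 * s * deriv (deriv prof) s) = 12 / A ^ 2 := by
  intro A a hA ha prof sJ hprof _hsJ hround s hs0 hs
  have hne : ∀ t : ℝ, 0 ≤ t → a ^ 2 + t ≠ 0 := fun t ht ↦ by positivity
  have hdiff : Differentiable ℝ prof := (contDiff_infty_iff_deriv.mp hprof).1
  have hdiff2 : Differentiable ℝ (deriv prof) :=
    (contDiff_infty_iff_deriv.mp (contDiff_infty_iff_deriv.mp hprof).2).1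
  -- first derivative on `[0, sJ)`
  have hd1 : ∀ t, 0 ≤ t → t < sJ → deriv prof t = -(2 * A * a) / (a ^ 2 + t) ^ 2 := by
    intro t ht0 ht
    refine RoundProfileCurvatureAux.deriv_eq_of_eqOn_Ico (hdiff t) ht (fun u hu1 hu2 ↦ ?_)
      (RoundProfileCurvatureAux.hasDerivAt_round A a (hne t ht0))
    exact hround u (ht0.trans hu1) hu2.le
  -- second derivative at `s`
  have hd2 : deriv (deriv prof) s = 4 * A * a / (a ^ 2 + s) ^ 3 :=
    RoundProfileCurvatureAux.deriv_eq_of_eqOn_Ico (hdiff2 s) hs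
      (fun u hu1 hu2 ↦ hd1 u (hs0.trans hu1) hu2)
      (RoundProfileCurvatureAux.hasDerivAt_round_deriv A a (hne s hs0))
  rw [hd1 s hs0 hs, hd2, hround s hs0 hs.le]
  have hpos : a ^ 2 + s ≠ 0 := hne s hs0
  field_simp
  ring

end Summit.SmoothPoincare4.SmoothPoincare4.Theorems

end
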